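import Summits.QuantumFields.YangMills.Theorems.LuscherReductionTwistedTraceScalingBOSliceCoreIndicators
import Summits.QuantumFields.YangMills.Theorems.LuscherReductionTwistedTraceScalingBOCentralRiderCancel
import Summits.QuantumFields.YangMills.Theorems.LuscherReductionTwistedTraceScalingBOCentralRelLink
import Summits.QuantumFields.YangMills.Theorems.LuscherReductionTwistedTraceScalingFPWeightCoreAt
import HarnessLib

/-!
# (C1c'-ι) THE SLICE REPRESENTATIVE OF A CHART POINT WITH ITS GAUGE PARAMETER: `P(w) = c · (tubePt p*)^{P∘ξ'}`, `ξ'` BASED and `O(Kρ)`, `‖p*‖ = O((1+K)ρ)` `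
# (lane A of S-BASE, crux `TwistedTraceScaling` stmt-QuantumFields-20203, C4-CORE, the (OD) pen; item (4') of `pub/ym-fleet/ym-luscher-20007-p1/COARSE-DESIGN.md` §28.5)

Step (4') of the (C1c') plan transfers the two-sided bounds on the gauge average of the BO function of record from SLICE tube points (`…BOLocalisedAvgSlice`,
`…BOGaugeAvgRiderLaplace`) to the CHART points `P(w) = latPatternChart L (fun _ ↦ false) w` of the (C1d) ball `Σ_a w_e a² ≤ ρ²`.  `…FPWeightOrbitRep.exists_slice_tubePt` produces the
slice representative but forgets the gauge transformation; here it is kept and normalised: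
* §1 ★ `exists_based_factorisation` — a gauge transformation `x ↦ (chartSU2 (ξ x))⁻¹` with `‖ξ x‖ ≤ a ≤ 1/8` is `c · (P∘ξ')` with `c = (chartSU2 (ξ 0))⁻¹` CONSTANT and `ξ'` BASED (`ξ' 0 = 0`),
  `‖ξ'‖ ≤ 3a` (`ξ'(x) = vecPart(chartSU2(ξ 0)·chartSU2(ξ x)⁻¹)`, `…PolarMean.vecPart_mul_inv`, `chartSU2_vecPart`);
* §2 ★★ `exists_slice_tubePt_based` — `exists_slice_tubePt` with the factorised gauge transformation exported: `U = c · (tubePt p*)^{P∘ξ'}`, `‖ξ'‖ ≤ 3K√(10τ)`;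
* §3 ★ `stiffGaussExp_constBased_orbit` (`q(relLinkVec (c·(tubePt p)^{P∘ξ'})) = q(basedFn (ξ',p))`, colour blindness + `…BOCentralRiderCancel.abs_stiffGaussExp_orbit_sub_le`),
  ★ `tubePt_rep_data` (fat-tube membership of the representative, `gaugeAvg φ (tubePt p) = gaugeAvg φ U`), ★ `latPatternChart_near_data` (`1 − ρ²/2 ≤ scalarPart`, Frobenius distance `≤ √2ρ`,
  `orbitDist (P w) ≤ |E|√2ρ`), `norm_chartVec_relLinkVec_data` (`‖chartVec w‖ ≤ √|E|ρ`, `‖chartVec w − relLinkVec (P w)‖ ≤ 7|E|ρ`);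
* §4 ★★★ `chartPoint_slice_rep` — on the chart ball (`ρ ≤ 1/5`, `3ρ < ε`, `3Kρ ≤ 1/8`, `((2+24K)ρ)²/4 ≤ 1/50`): `P(w) = c · (tubePt p*)^{P∘ξ'}`, `‖ξ'‖ ≤ 9Kρ`, `p*` on the slice,
  `1 − ((2+24K)ρ)²/4 ≤ scalarPart((tubePt p*)_e)`, `‖p*‖ ≤ (4+48K)ρ`;
* §5 ★★★ `chart_rep_transfer` — `‖linkEmbed p*.1‖ ≤ ‖chartVec w‖ + 7|E|ρ + 9BKρ + M_T(9Kρ)²` and `|q(chartVec w) − q(linkEmbed p*.1)| ≤ (96t+b)·(D'(2‖linkEmbed p*.1‖ + D') + 72|E|ρ³)`,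
  `D' = 9C_L K(4+48K)ρ² + 81M_T K²ρ²` (`…BOCentralRelLink` + §3; the leading displacement `−∇ξ'` is a pure gauge, invisible to `q`).
With `ρ = O(Lβ^{-1/2}ℓ²)`, `‖chartVec w‖ = O(β^{-1/2}·polylog)`: the transfer costs `(96t+b)·O(ρ²‖chartVec w‖ + ρ³) = O(β^{-1/2}·polylog) → 0`.
HONEST FRAMING: chart/slice geometry for a stub of a child of the CONDITIONAL route R2b1; (C1c') (4') assembly, (5), rates, (C4), (C5), (B-ST) OPEN; C4-CORE OPEN; not infinite volume, not a gap,
not Clay.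
-/

set_option autoImplicit false

noncomputable section

open MeasureTheory Real
open scoped BigOperators RealInnerProductSpace Matrix
open Literature.MathematicalPhysics.QuantumFieldTheory
open Literature.MathematicalPhysics.QuantumLattice

namespace Summit.QuantumFields.YangMills.Theorems.FemtoTransferGap.TwoLattice.ConstTube

open Summit.QuantumFields.YangMills.Theorems.FemtoTransferGap
open Summit.QuantumFields.YangMills.Theorems.FemtoTransferGap.TwoLattice
open Summit.QuantumFields.YangMills.Theorems.FemtoTransferGap.TwoLattice.Avg
open Summit.QuantumFields.YangMills.Theorems.FemtoTransferGap.TwoLattice.Stiff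
open Summit.QuantumFields.YangMills.Theorems.FemtoTransferGap.TwoLattice.GnChart
open Summit.QuantumFields.YangMills.Theorems.FemtoTransferGap.TwoLattice.Cov (scalarPart_inv vecPart_inv)

variable {L : ℕ} [NeZero L]

/-! ## §1 A small gauge transformation is a constant times a small BASED one -/

/-- For `u : Fin 3 → ℝ` with `‖u‖ ≤ a ≤ 1/2` (sup norm): `Σ_c u_c² ≤ 3a² ≤ 1`. [folklore] -/
theorem sum_sq_le_of_pi_norm_le {u : Fin 3 → ℝ} {a : ℝ} (hu : ‖u‖ ≤ a) : ∑ c, u c ^ 2 ≤ 3 * a ^ 2 := by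
  have h : ∀ c, u c ^ 2 ≤ a ^ 2 := fun c => by
    have h1 : |u c| ≤ a := by have := norm_le_pi_norm u c; rw [Real.norm_eq_abs] at this; exact this.trans hu
    rw [← sq_abs]; exact pow_le_pow_left₀ (abs_nonneg _) h1 2
  calc ∑ c, u c ^ 2 ≤ ∑ _c : Fin 3, a ^ 2 := Finset.sum_le_sum fun c _ => h c
    _ = 3 * a ^ 2 := by simp

/-- ★ **A small gauge transformation is a constant one times a small BASED one.**  If `‖ξ x‖ ≤ a ≤ 1/8` for every site, then
`(P∘ξ)⁻¹ = c · (P∘ξ')` with `c = (chartSU2 (ξ 0))⁻¹`, `ξ'` based (`ξ' 0 = 0`) and `‖ξ'‖ ≤ 3a`. [folklore] -/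
theorem exists_based_factorisation {ξ : Site 3 L → Fin 3 → ℝ} {a : ℝ} (ha : a ≤ 1 / 8) (hξ : ∀ x, ‖ξ x‖ ≤ a) :
    ∃ (c : SU2) (ξ' : basedSubmodule L), (fun x => (chartSU2 (ξ x))⁻¹) = (fun _ => c) * (fun x => chartSU2 ((ξ' : Site 3 L → Fin 3 → ℝ) x)) ∧
      ‖ξ'‖ ≤ 3 * a ∧ c = (chartSU2 (ξ 0))⁻¹ := by
  have ha0 : 0 ≤ a := (norm_nonneg _).trans (hξ 0)
  have hsum : ∀ x, ∑ c, ξ x c ^ 2 ≤ 3 * a ^ 2 := fun x => sum_sq_le_of_pi_norm_le (hξ x)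
  have h3a : 3 * a ^ 2 ≤ 1 := by nlinarith
  have hsum1 : ∀ x, ∑ c, ξ x c ^ 2 ≤ 1 := fun x => (hsum x).trans h3a
  -- scalar and vector parts of the chart elements
  have hsc : ∀ x, Real.sqrt (1 - 3 * a ^ 2) ≤ scalarPart (chartSU2 (ξ x)) := fun x => by
    rw [scalarPart_chartSU2 (hsum1 x)]; exact Real.sqrt_le_sqrt (by linarith [hsum x])
  have hsc1 : ∀ x, scalarPart (chartSU2 (ξ x)) ≤ 1 := fun x => by
    rw [scalarPart_chartSU2 (hsum1 x)]
    calc Real.sqrt (1 - ∑ c, ξ x c ^ 2) ≤ Real.sqrt 1 := Real.sqrt_le_sqrt (by linarith [Finset.sum_nonneg fun c (_ : c ∈ Finset.univ) => sq_nonneg (ξ x c)])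
      _ = 1 := Real.sqrt_one
  have hsc0 : ∀ x, 0 ≤ scalarPart (chartSU2 (ξ x)) := fun x => (Real.sqrt_nonneg _).trans (hsc x)
  have hvec : ∀ x, vecPart (chartSU2 (ξ x)) = ξ x := fun x => vecPart_chartSU2 (hsum1 x)
  have habs : ∀ x i, |ξ x i| ≤ a := fun x i => by
    have := norm_le_pi_norm (ξ x) i; rw [Real.norm_eq_abs] at this; exact this.trans (hξ x)
  -- the based factor
  set c : SU2 := (chartSU2 (ξ 0))⁻¹ with hc
  set h : Site 3 L → SU2 := fun x => chartSU2 (ξ 0) * (chartSU2 (ξ x))⁻¹ with hh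
  have hh0 : h 0 = 1 := by simp [hh]
  -- `scalarPart (h x) > 0`
  have hroot : 1 / 2 ≤ Real.sqrt (1 - 3 * a ^ 2) := by
    rw [show (1 : ℝ) / 2 = Real.sqrt ((1 / 2) ^ 2) by rw [Real.sqrt_sq (by norm_num)]]
    exact Real.sqrt_le_sqrt (by nlinarith)
  have hdot : ∀ x, |vecPart (chartSU2 (ξ 0)) ⬝ᵥ vecPart (chartSU2 (ξ x))| ≤ 3 * a ^ 2 := fun x => by
    rw [hvec, hvec, dotProduct, Fin.sum_univ_three]
    have h1 : ∀ i, |ξ 0 i * ξ x i| ≤ a * a := fun i => by rw [abs_mul]; exact mul_le_mul (habs 0 i) (habs x i) (abs_nonneg _) ha0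
    have := abs_add_three (ξ 0 0 * ξ x 0) (ξ 0 1 * ξ x 1) (ξ 0 2 * ξ x 2)
    nlinarith [h1 0, h1 1, h1 2]
  have hscal : ∀ x, 0 ≤ scalarPart (h x) := fun x => by
    simp only [hh]
    rw [scalarPart_mul, scalarPart_inv, vecPart_inv, dotProduct_neg]
    have h1 : Real.sqrt (1 - 3 * a ^ 2) * Real.sqrt (1 - 3 * a ^ 2) ≤ scalarPart (chartSU2 (ξ 0)) * scalarPart (chartSU2 (ξ x)) :=
      mul_le_mul (hsc 0) (hsc x) (Real.sqrt_nonneg _) (hsc0 0)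
    have h2 := (abs_le.1 (hdot x)).1
    nlinarith [hroot]
  -- the based parameter
  set ξ'f : Site 3 L → Fin 3 → ℝ := fun x => vecPart (h x) with hξ'f
  have hξ'0 : ξ'f 0 = 0 := by
    simp only [hξ'f, hh0]
    funext i; fin_cases i <;> simp [vecPart, su2Quat_one, Quaternion.imI_one, Quaternion.imJ_one, Quaternion.imK_one]
  have hmem : ξ'f ∈ basedSubmodule L := hξ'0
  refine ⟨c, ⟨ξ'f, hmem⟩, ?_, ?_, rfl⟩
  · funext x
    simp only [Pi.mul_apply, hξ'f]
    rw [chartSU2_vecPart (h x) (hscal x), hh, hc, ← mul_assoc, inv_mul_cancel, one_mul]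
  · -- `‖ξ'‖ ≤ 3a`: components of `vecPart (A B⁻¹) = −s_A v_B + s_B v_A − v_A × v_B`
    rw [Submodule.coe_norm, Submodule.coe_mk]
    refine (pi_norm_le_iff_of_nonneg (by positivity)).2 fun x => (pi_norm_le_iff_of_nonneg (by positivity)).2 fun i => ?_
    rw [Real.norm_eq_abs]
    show |vecPart (chartSU2 (ξ 0) * (chartSU2 (ξ x))⁻¹) i| ≤ 3 * a
    rw [vecPart_mul_inv]
    have hcross := abs_crossProduct_apply_le (a := vecPart (chartSU2 (ξ 0))) (b := vecPart (chartSU2 (ξ x))) (A := a) (B := a)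
      (fun j => by rw [hvec]; exact habs 0 j) (fun j => by rw [hvec]; exact habs x j) i
    have h1 : |(-(scalarPart (chartSU2 (ξ 0)) • vecPart (chartSU2 (ξ x)))) i| ≤ a := by
      rw [Pi.neg_apply, abs_neg, Pi.smul_apply, smul_eq_mul, abs_mul, abs_of_nonneg (hsc0 0), hvec]
      calc _ ≤ 1 * a := mul_le_mul (hsc1 0) (habs x i) (abs_nonneg _) zero_le_one
        _ = a := one_mul a
    have h2 : |(scalarPart (chartSU2 (ξ x)) • vecPart (chartSU2 (ξ 0))) i| ≤ a := by
      rw [Pi.smul_apply, smul_eq_mul, abs_mul, abs_of_nonneg (hsc0 x), hvec]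
      calc _ ≤ 1 * a := mul_le_mul (hsc1 x) (habs 0 i) (abs_nonneg _) zero_le_one
        _ = a := one_mul a
    have h12 := abs_add_le ((-(scalarPart (chartSU2 (ξ 0)) • vecPart (chartSU2 (ξ x)))) i) ((scalarPart (chartSU2 (ξ x)) • vecPart (chartSU2 (ξ 0))) i)
    have h123 := abs_sub ((-(scalarPart (chartSU2 (ξ 0)) • vecPart (chartSU2 (ξ x))) + scalarPart (chartSU2 (ξ x)) • vecPart (chartSU2 (ξ 0))) i)
      ((vecPart (chartSU2 (ξ 0)) ⨯₃ vecPart (chartSU2 (ξ x))) i)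
    rw [Pi.sub_apply]
    rw [Pi.add_apply] at h123 ⊢
    nlinarith [hcross, h1, h2, h12, h123, ha0]

/-! ## §2 ★★ The slice representative with its gauge parameter -/

/-- ★★ **EVERY NEAR-VACUUM CONFIGURATION IS A CONSTANT GAUGE COPY OF A SMALL BASED GAUGE COPY OF A SLICE TUBE POINT.**  As `…FPWeightOrbitRep.exists_slice_tubePt` (constants `K, ε` of
`exists_slicePoint`; `1 − τ ≤ scalarPart(U_e)` on every link; `τ` small), but the gauge transformation is exported: `U = c · (tubePt p*)^{P∘ξ'}` with `c ∈ SU(2)` constant, `ξ'` BASED and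
`‖ξ'‖ ≤ 3K√(10τ)` (this needs `K√(10τ) ≤ 1/8`), `p*` on the slice, `1 − R²/4 ≤ scalarPart((tubePt p*)_e)`, `‖p*‖ ≤ max(√(10·R²/4), 2√(2·R²/4))`, `R = 2√τ + 8K√(10τ)`. [folklore] -/
theorem exists_slice_tubePt_based {K ε : ℝ} (hK : 0 ≤ K)
    (hSP : ∀ w : Edge 3 L → Fin 3 → ℝ, w ∈ balancedSet L → ∀ c : Fin 3 → Fin 3 → ℝ, ‖w‖ < ε → ‖c‖ < ε →
      ∃ ξ : Site 3 L → Fin 3 → ℝ, ∑ x : Site 3 L, ξ x = 0 ∧ ‖ξ‖ ≤ K * ‖w‖ ∧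
        gaugeCoordSq L (gaugeTransform (fun x => chartSU2 (ξ x)) (orthoTube L (fun e₁ => chartSU2 (c e₁.2)) w)) = 0)
    {τ : ℝ} (hτ0 : 0 ≤ τ) (hτ : τ ≤ 1 / 50) (hτε1 : Real.sqrt (10 * τ) < ε) (hτε2 : 2 * Real.sqrt (2 * τ) < ε) (hτK : K * Real.sqrt (10 * τ) ≤ 1 / 8)
    (hτ' : (2 * Real.sqrt τ + 8 * (K * Real.sqrt (10 * τ))) ^ 2 / 4 ≤ 1 / 50)
    {U : GaugeConfig 3 L SU2} (hU : ∀ e : Edge 3 L, 1 - τ ≤ scalarPart (U e)) :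
    ∃ (c : SU2) (ξ' : basedSubmodule L) (p : balancedSubmodule L × (Fin 3 → Fin 3 → ℝ)),
      U = gaugeTransform (fun _ : Site 3 L => c) (gaugeTransform (fun x => chartSU2 ((ξ' : Site 3 L → Fin 3 → ℝ) x)) (tubePt L p)) ∧
      ‖ξ'‖ ≤ 3 * (K * Real.sqrt (10 * τ)) ∧
      (gaugeModes L).starProjection (linkEmbed L (p.1 : Edge 3 L → Fin 3 → ℝ)) = 0 ∧
      (∀ e : Edge 3 L, 1 - (2 * Real.sqrt τ + 8 * (K * Real.sqrt (10 * τ))) ^ 2 / 4 ≤ scalarPart (tubePt L p e)) ∧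
      tubePt L p ∈ nearOne L (2 * Real.sqrt τ + 8 * (K * Real.sqrt (10 * τ)) + 1) ∧
      ‖p‖ ≤ max (Real.sqrt (10 * ((2 * Real.sqrt τ + 8 * (K * Real.sqrt (10 * τ))) ^ 2 / 4)))
        (2 * Real.sqrt (2 * ((2 * Real.sqrt τ + 8 * (K * Real.sqrt (10 * τ))) ^ 2 / 4))) := by
  -- chart at `U`
  obtain ⟨hrec, hbal, hv, hc⟩ := orthoTube_slowMean_chart L hτ0 hτ hU
  set v : Edge 3 L → Fin 3 → ℝ := fun e => vecPart (U e * (polarMean L e.2 U)⁻¹) with hvdef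
  set c : Fin 3 → Fin 3 → ℝ := fun k => vecPart (polarMean L k U) with hcdef
  have hvn : ‖v‖ ≤ Real.sqrt (10 * τ) := (pi_norm_le_iff_of_nonneg (Real.sqrt_nonneg _)).mpr hv
  have hcn : ‖c‖ ≤ 2 * Real.sqrt (2 * τ) := (pi_norm_le_iff_of_nonneg (by positivity)).mpr hc
  -- slice point on the orbit
  obtain ⟨ξ, -, hξK, hslice⟩ := hSP v hbal c (lt_of_le_of_lt hvn hτε1) (lt_of_le_of_lt hcn hτε2)
  have hξn : ∀ x, ‖ξ x‖ ≤ K * Real.sqrt (10 * τ) := fun x =>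
    (norm_le_pi_norm ξ x).trans (hξK.trans (mul_le_mul_of_nonneg_left hvn hK))
  set U' : GaugeConfig 3 L SU2 := gaugeTransform (fun x => chartSU2 (ξ x)) U with hU'
  have hUeq : orthoTube L (fun e₁ => chartSU2 (c e₁.2)) v = U := hrec
  have hslice' : gaugeCoordSq L U' = 0 := by rw [hU', ← hUeq]; exact hslice
  -- `U'` is near the vacuum
  set R : ℝ := 2 * Real.sqrt τ + 8 * (K * Real.sqrt (10 * τ)) with hR
  have hU'frob : ∀ e : Edge 3 L, frobNorm (((U' e : SU2) : Matrix (Fin 2) (Fin 2) ℂ) - 1) ≤ R := fun e => by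
    have h1 := frobNorm_gaugeTransform_sub_one_le L (fun x => chartSU2 (ξ x)) U e
    have h2 := frobNorm_chartSU2_sub_one_le ((hξn e.1).trans (by linarith))
    have h3 := frobNorm_chartSU2_sub_one_le ((hξn (e.1.shift e.2)).trans (by linarith))
    have h4 := frobNorm_le_of_scalarPart_ge hτ0 (hU e)
    have h5 := hξn e.1
    have h6 := hξn (e.1.shift e.2)
    rw [hR]; rw [hU']
    linarith
  set τ' : ℝ := R ^ 2 / 4 with hτ'def
  have hτ'0 : 0 ≤ τ' := by positivity
  have hU'sc : ∀ e : Edge 3 L, 1 - τ' ≤ scalarPart (U' e) := fun e => scalarPart_ge_of_frobNorm_le (hU'frob e)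
  -- chart at `U'`
  obtain ⟨hrec', hbal', hv', hc'⟩ := orthoTube_slowMean_chart L hτ'0 (by rw [hτ'def, hR]; exact hτ') hU'sc
  set v' : Edge 3 L → Fin 3 → ℝ := fun e => vecPart (U' e * (polarMean L e.2 U')⁻¹) with hv'def
  set c' : Fin 3 → Fin 3 → ℝ := fun k => vecPart (polarMean L k U') with hc'def
  -- the based factorisation of `(P∘ξ)⁻¹`
  obtain ⟨c₀, ξ', hfac, hξ'n, -⟩ := exists_based_factorisation (L := L) hτK hξn
  have hUback : U = gaugeTransform (fun _ : Site 3 L => c₀) (gaugeTransform (fun x => chartSU2 ((ξ' : Site 3 L → Fin 3 → ℝ) x)) U') := by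
    rw [gaugeTransform_gaugeTransform, ← hfac, hU', gaugeTransform_inv_gaugeTransform]
  refine ⟨c₀, ξ', (⟨v', hbal'⟩, c'), ?_, hξ'n, ?_, ?_, ?_, ?_⟩
  · -- `U = c₀ · (tubePt p*)^{P∘ξ'}`, `tubePt p* = U'`
    rw [show tubePt L (⟨v', hbal'⟩, c') = U' from hrec']; exact hUback
  · -- slice: `linkEmbed v' = relLinkVec U'`
    have hle : linkEmbed L v' = relLinkVec L U' := by ext ea; rfl
    rw [show ((⟨v', hbal'⟩ : balancedSubmodule L) : Edge 3 L → Fin 3 → ℝ) = v' from rfl, hle]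
    have h0 : ‖(gaugeModes L).starProjection (relLinkVec L U')‖ ^ 2 = 0 := hslice'
    exact norm_eq_zero.mp (pow_eq_zero_iff two_ne_zero |>.mp h0)
  · intro e; rw [show tubePt L (⟨v', hbal'⟩, c') = U' from hrec']; exact hU'sc e
  · intro e; rw [show tubePt L (⟨v', hbal'⟩, c') = U' from hrec']
    exact lt_of_le_of_lt (hU'frob e) (by linarith)
  · rw [Prod.norm_def]
    refine max_le_max ?_ ?_
    · rw [Submodule.coe_norm]; exact (pi_norm_le_iff_of_nonneg (Real.sqrt_nonneg _)).mpr hv'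
    · exact (pi_norm_le_iff_of_nonneg (by positivity)).mpr hc'

/-! ## §3 Consequences: the stiff exponent along the orbit, the tube data of the representative, chart points -/

/-- ★ **The stiff exponent of a constant-times-based gauge copy of a slice tube point**: for `U = c · (tubePt p)^{P∘ξ'}` with `‖ξ'‖ < ε_T`, `‖p‖ < ε_T`, `‖p‖ ≤ 1/40`:
`q(relLinkVec U) = q(basedFn (ξ', p))` and `|q(relLinkVec U) − q(linkEmbed p.1)| ≤ (96t+b)·D'·(2‖linkEmbed p.1‖ + D')`, `D' = C_L‖p‖‖ξ'‖ + M‖ξ'‖²` (`q` is colour blind; the gauge-mode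
cancellation `…BOCentralRiderCancel.abs_stiffGaussExp_orbit_sub_le`). [folklore] -/
theorem stiffGaussExp_constBased_orbit {t : ℝ} (ht : 0 ≤ t) {b : ℝ} (hb : 0 ≤ b) (p : balancedSubmodule L × (Fin 3 → Fin 3 → ℝ))
    {εT M : ℝ} (hM0 : 0 ≤ M)
    (hT : ∀ (ξ : basedSubmodule L) (q : balancedSubmodule L × (Fin 3 → Fin 3 → ℝ)), ‖ξ‖ < εT → ‖q‖ < εT →
      ‖basedFn L (ξ, q) - basedFn L (0, q) - basedLin L q ξ‖ ≤ M * ‖ξ‖ ^ 2)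
    {CL : ℝ} (hCL : 0 ≤ CL) (hLip : ∀ ξ : basedSubmodule L, ‖(basedLin L p - basedLin L 0) ξ‖ ≤ CL * ‖p‖ * ‖ξ‖)
    (hpT : ‖p‖ < εT) (hp40 : ‖p‖ ≤ 1 / 40) {ξ' : basedSubmodule L} (hξ' : ‖ξ'‖ < εT) (c : SU2) :
    let D' := CL * ‖p‖ * ‖ξ'‖ + M * ‖ξ'‖ ^ 2
    stiffGaussExp L t b (relLinkVec L (gaugeTransform (fun _ : Site 3 L => c) (gaugeTransform (fun x => chartSU2 ((ξ' : Site 3 L → Fin 3 → ℝ) x)) (tubePt L p)))) =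
        stiffGaussExp L t b (basedFn L (ξ', p)) ∧
      |stiffGaussExp L t b (relLinkVec L (gaugeTransform (fun _ : Site 3 L => c) (gaugeTransform (fun x => chartSU2 ((ξ' : Site 3 L → Fin 3 → ℝ) x)) (tubePt L p)))) -
          stiffGaussExp L t b (linkEmbed L (p.1 : Edge 3 L → Fin 3 → ℝ))| ≤
        (96 * t + b) * D' * (2 * ‖linkEmbed L (p.1 : Edge 3 L → Fin 3 → ℝ)‖ + D') := by
  intro D'
  have heq : stiffGaussExp L t b (relLinkVec L (gaugeTransform (fun _ : Site 3 L => c) (gaugeTransform (fun x => chartSU2 ((ξ' : Site 3 L → Fin 3 → ℝ) x)) (tubePt L p)))) =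
      stiffGaussExp L t b (basedFn L (ξ', p)) := by
    rw [relLinkVec_conj, stiffGaussExp_adL, relLinkVec_gaugeTransform_tubePt]
  refine ⟨heq, ?_⟩
  rw [heq]
  exact abs_stiffGaussExp_orbit_sub_le ht hb p hM0 hT hCL hLip hpT hp40 hξ'

/-- ★ **The tube data of the slice representative**: if `U = c · (tubePt p)^{P∘ξ'}` with `1 − R²/4 ≤ scalarPart((tubePt p)_e)` (`0 ≤ R < ρ₁`) and `orbitDist U < δ β`, then
`tubePt p ∈ fatTubeRho δ (fun _ ↦ ρ₁) β` and `N(tubePt p) = N(U)` for every gauge-invariant `N = gaugeAvg φ`. [folklore] -/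
theorem tubePt_rep_data {δ : ℝ → ℝ} {β : ℝ} {U : GaugeConfig 3 L SU2} {c : SU2} {ξ' : basedSubmodule L} {p : balancedSubmodule L × (Fin 3 → Fin 3 → ℝ)}
    (hU : U = gaugeTransform (fun _ : Site 3 L => c) (gaugeTransform (fun x => chartSU2 ((ξ' : Site 3 L → Fin 3 → ℝ) x)) (tubePt L p)))
    {R ρ₁ : ℝ} (hR : 0 ≤ R) (hRρ : R < ρ₁) (hsc : ∀ e : Edge 3 L, 1 - R ^ 2 / 4 ≤ scalarPart (tubePt L p e)) (horb : orbitDist U < δ β) :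
    tubePt L p ∈ fatTubeRho L δ (fun _ => ρ₁) β ∧ orbitDist (tubePt L p) = orbitDist U ∧
      ∀ φ : GaugeConfig 3 L SU2 → ℝ, gaugeAvg φ (tubePt L p) = gaugeAvg φ U := by
  have horb' : orbitDist (tubePt L p) = orbitDist U := by
    rw [hU, orbitDist_gaugeTransform, orbitDist_gaugeTransform]
  refine ⟨⟨fun e => lt_of_le_of_lt (frobNorm_le_of_scalarPart_ge' hR (hsc e)) hRρ, ?_⟩, horb', fun φ => ?_⟩
  · show orbitDist (tubePt L p) < δ β
    rw [horb']; exact horb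
  · rw [hU, gaugeAvg_gaugeTransform, gaugeAvg_gaugeTransform]

/-- ★ **Chart points are near-vacuum configurations**: on the chart ball `Σ_a w_e a² ≤ ρ²` (`0 ≤ ρ`), every link of `P(w)` has `1 − ρ²/2 ≤ scalarPart`, Frobenius distance `≤ √2·ρ` from `1`,
`P(w) ∈ nearOne (√2ρ + anything positive)`, and `orbitDist (P w) ≤ |E|·√2·ρ`. [folklore] -/
theorem latPatternChart_near_data {ρ : ℝ} (hρ0 : 0 ≤ ρ) {w : Edge 3 L → Fin 3 → ℝ} (hw : ∀ e, ∑ a, w e a ^ 2 ≤ ρ ^ 2) :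
    (∀ e : Edge 3 L, 1 - ρ ^ 2 / 2 ≤ scalarPart (latPatternChart L (fun _ => false) w e)) ∧
      (∀ e : Edge 3 L, frobNorm (((latPatternChart L (fun _ => false) w e : SU2) : Matrix (Fin 2) (Fin 2) ℂ) - 1) ≤ Real.sqrt 2 * ρ) ∧
      orbitDist (latPatternChart L (fun _ => false) w) ≤ Fintype.card (Edge 3 L) * (Real.sqrt 2 * ρ) := by
  have hsc : ∀ e : Edge 3 L, 1 - ρ ^ 2 / 2 ≤ scalarPart (latPatternChart L (fun _ => false) w e) := fun e => (latPatternChart_link_data hρ0 hw e).1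
  have hfrob : ∀ e : Edge 3 L, frobNorm (((latPatternChart L (fun _ => false) w e : SU2) : Matrix (Fin 2) (Fin 2) ℂ) - 1) ≤ Real.sqrt 2 * ρ := fun e => by
    have h := frobNorm_le_of_scalarPart_ge (by positivity : (0 : ℝ) ≤ ρ ^ 2 / 2) (hsc e)
    have hs : Real.sqrt (ρ ^ 2 / 2) = ρ / Real.sqrt 2 := by
      rw [Real.sqrt_div (sq_nonneg ρ), Real.sqrt_sq hρ0]
    rw [hs] at h
    have h2 : (2 : ℝ) * (ρ / Real.sqrt 2) = Real.sqrt 2 * ρ := by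
      have hs2 : Real.sqrt 2 * Real.sqrt 2 = 2 := Real.mul_self_sqrt (by norm_num)
      field_simp; nlinarith [hs2]
    linarith
  refine ⟨hsc, hfrob, ?_⟩
  calc orbitDist (latPatternChart L (fun _ => false) w) ≤ gaugeDist 1 (latPatternChart L (fun _ => false) w) := orbitDist_le 1 _
    _ = ∑ e : Edge 3 L, frobNorm (((latPatternChart L (fun _ => false) w e : SU2) : Matrix (Fin 2) (Fin 2) ℂ) - 1) := by
        unfold gaugeDist; rw [TT.gaugeTransform_one']
    _ ≤ ∑ _e : Edge 3 L, Real.sqrt 2 * ρ := Finset.sum_le_sum fun e _ => hfrob e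
    _ = Fintype.card (Edge 3 L) * (Real.sqrt 2 * ρ) := by simp

/-- The chart coordinate and the relative coordinate of a chart point: `‖chartVec w‖ ≤ √|E|·ρ` and `‖chartVec w − relLinkVec (P w)‖ ≤ 7|E|ρ` on the chart ball (`0 ≤ ρ ≤ 1/5`;
constant mode `≤ 2ρ` plus `7ρ²` per component, `…BOCentralRelLink.relLinkVec_chart_decomposition`). [folklore] -/
theorem norm_chartVec_relLinkVec_data {ρ : ℝ} (hρ0 : 0 ≤ ρ) (hρ5 : ρ ≤ 1 / 5) {w : Edge 3 L → Fin 3 → ℝ} (hw : ∀ e, ∑ a, w e a ^ 2 ≤ ρ ^ 2) :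
    ‖chartVec w‖ ≤ Real.sqrt (Fintype.card (Edge 3 L)) * ρ ∧
      ‖chartVec w - relLinkVec L (latPatternChart L (fun _ => false) w)‖ ≤ 7 * Fintype.card (Edge 3 L) * ρ := by
  set V := latPatternChart L (fun _ => false) w with hV
  set E : ℝ := (Fintype.card (Edge 3 L) : ℝ) with hE
  have hE1 : 1 ≤ E := by rw [hE]; exact_mod_cast Fintype.card_pos
  set κ : LinkSpace L := WithLp.toLp 2 fun ea : Edge 3 L × Fin 3 => vecPart (polarMean L ea.1.2 V) ea.2 with hκ
  have hx_sq : ‖chartVec w‖ ^ 2 ≤ E * ρ ^ 2 := by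
    rw [norm_chartVec_sq]
    calc ∑ e, ∑ a, w e a ^ 2 ≤ ∑ _e : Edge 3 L, ρ ^ 2 := Finset.sum_le_sum fun e _ => hw e
      _ = E * ρ ^ 2 := by rw [Finset.sum_const, Finset.card_univ, nsmul_eq_mul]
  have h1 : ‖chartVec w‖ ≤ Real.sqrt E * ρ := by
    have h : Real.sqrt (‖chartVec w‖ ^ 2) ≤ Real.sqrt (E * ρ ^ 2) := Real.sqrt_le_sqrt hx_sq
    rwa [Real.sqrt_sq (norm_nonneg _), Real.sqrt_mul (by positivity), Real.sqrt_sq hρ0] at h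
  refine ⟨h1, ?_⟩
  -- every component of `chartVec w − relLinkVec V` is at most `2ρ + 7ρ² ≤ 4ρ`
  have hcomp : ∀ ea : Edge 3 L × Fin 3, |(chartVec w - relLinkVec L V) ea| ≤ 4 * ρ := fun ea => by
    obtain ⟨e, a⟩ := ea
    have hrem := relLinkVec_chart_decomposition hρ0 hρ5 hw e a
    obtain ⟨_, hκa, _, _⟩ := latPatternChart_polarMean_data hρ0 (by linarith) hw e.2
    have hκ' : |κ (e, a)| ≤ 2 * ρ := by simp only [hκ]; exact hκa a
    have hsplit : (chartVec w - relLinkVec L V) (e, a) = (chartVec w - relLinkVec L V - κ) (e, a) + κ (e, a) := by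
      simp only [WithLp.ofLp_sub, Pi.sub_apply]; ring
    rw [hsplit]
    have := abs_add_le ((chartVec w - relLinkVec L V - κ) (e, a)) (κ (e, a))
    rw [← hV, ← hκ] at hrem
    nlinarith
  have hsq : ‖chartVec w - relLinkVec L V‖ ^ 2 ≤ 3 * E * (4 * ρ) ^ 2 := by
    rw [EuclideanSpace.norm_sq_eq]
    calc ∑ ea, ‖(chartVec w - relLinkVec L V) ea‖ ^ 2 ≤ ∑ _ea : Edge 3 L × Fin 3, (4 * ρ) ^ 2 := Finset.sum_le_sum fun ea _ => by
          rw [Real.norm_eq_abs]; exact pow_le_pow_left₀ (abs_nonneg _) (hcomp ea) 2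
      _ = 3 * E * (4 * ρ) ^ 2 := by rw [Finset.sum_const, Finset.card_univ, Fintype.card_prod, Fintype.card_fin, nsmul_eq_mul]; push_cast; rw [hE]; ring
  have hsq' : ‖chartVec w - relLinkVec L V‖ ^ 2 ≤ (7 * E * ρ) ^ 2 := by
    calc _ ≤ 3 * E * (4 * ρ) ^ 2 := hsq
      _ = 48 * E * ρ ^ 2 := by ring
      _ ≤ 49 * E ^ 2 * ρ ^ 2 := by nlinarith [sq_nonneg ρ]
      _ = (7 * E * ρ) ^ 2 := by ring
  exact (pow_le_pow_iff_left₀ (norm_nonneg _) (by positivity) two_ne_zero).1 hsq'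

/-! ## §4 ★★★ The slice representative of a chart point -/

/-- Square roots at `τ = ρ²/2`: `√τ ≤ ρ`, `√(10τ) ≤ 3ρ`, `√(2τ) = ρ` (`ρ ≥ 0`). [folklore] -/
theorem sqrt_half_sq_data {ρ : ℝ} (hρ0 : 0 ≤ ρ) :
    Real.sqrt (ρ ^ 2 / 2) ≤ ρ ∧ Real.sqrt (10 * (ρ ^ 2 / 2)) ≤ 3 * ρ ∧ Real.sqrt (2 * (ρ ^ 2 / 2)) = ρ := by
  refine ⟨?_, ?_, ?_⟩
  · calc Real.sqrt (ρ ^ 2 / 2) ≤ Real.sqrt (ρ ^ 2) := Real.sqrt_le_sqrt (by nlinarith [sq_nonneg ρ])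
      _ = ρ := Real.sqrt_sq hρ0
  · calc Real.sqrt (10 * (ρ ^ 2 / 2)) ≤ Real.sqrt ((3 * ρ) ^ 2) := Real.sqrt_le_sqrt (by nlinarith [sq_nonneg ρ])
      _ = 3 * ρ := Real.sqrt_sq (by positivity)
  · rw [show 2 * (ρ ^ 2 / 2) = ρ ^ 2 by ring, Real.sqrt_sq hρ0]

/-- ★★★ **THE SLICE REPRESENTATIVE OF A CHART POINT.**  Let `K, ε` be the constants of `exists_slicePoint`.  On the chart ball `Σ_a w_e a² ≤ ρ²` with `0 ≤ ρ ≤ 1/5`, `3ρ < ε`, `3Kρ ≤ 1/8`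
and `((2+24K)ρ)²/4 ≤ 1/50`:  `P(w) = c · (tubePt p*)^{P∘ξ'}` with `c ∈ SU(2)` constant, `ξ'` based, `‖ξ'‖ ≤ 9Kρ`, `p*` on the slice, `1 − ((2+24K)ρ)²/4 ≤ scalarPart((tubePt p*)_e)` and
`‖p*‖ ≤ (4+48K)ρ`. [folklore] -/
theorem chartPoint_slice_rep {K ε : ℝ} (hK : 0 ≤ K)
    (hSP : ∀ w : Edge 3 L → Fin 3 → ℝ, w ∈ balancedSet L → ∀ c : Fin 3 → Fin 3 → ℝ, ‖w‖ < ε → ‖c‖ < ε →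
      ∃ ξ : Site 3 L → Fin 3 → ℝ, ∑ x : Site 3 L, ξ x = 0 ∧ ‖ξ‖ ≤ K * ‖w‖ ∧
        gaugeCoordSq L (gaugeTransform (fun x => chartSU2 (ξ x)) (orthoTube L (fun e₁ => chartSU2 (c e₁.2)) w)) = 0)
    {ρ : ℝ} (hρ0 : 0 ≤ ρ) (hρ5 : ρ ≤ 1 / 5) (hρε : 3 * ρ < ε) (hρK : 3 * K * ρ ≤ 1 / 8) (hR50 : ((2 + 24 * K) * ρ) ^ 2 / 4 ≤ 1 / 50)
    {w : Edge 3 L → Fin 3 → ℝ} (hw : ∀ e, ∑ a, w e a ^ 2 ≤ ρ ^ 2) :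
    ∃ (c : SU2) (ξ' : basedSubmodule L) (p : balancedSubmodule L × (Fin 3 → Fin 3 → ℝ)),
      latPatternChart L (fun _ => false) w = gaugeTransform (fun _ : Site 3 L => c) (gaugeTransform (fun x => chartSU2 ((ξ' : Site 3 L → Fin 3 → ℝ) x)) (tubePt L p)) ∧
      ‖ξ'‖ ≤ 9 * K * ρ ∧
      (gaugeModes L).starProjection (linkEmbed L (p.1 : Edge 3 L → Fin 3 → ℝ)) = 0 ∧
      (∀ e : Edge 3 L, 1 - ((2 + 24 * K) * ρ) ^ 2 / 4 ≤ scalarPart (tubePt L p e)) ∧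
      ‖p‖ ≤ (4 + 48 * K) * ρ := by
  obtain ⟨hs1, hs10, hs2⟩ := sqrt_half_sq_data hρ0
  set τ : ℝ := ρ ^ 2 / 2 with hτ
  have hτ0 : 0 ≤ τ := by positivity
  have hτ50 : τ ≤ 1 / 50 := by rw [hτ]; nlinarith
  have hτε1 : Real.sqrt (10 * τ) < ε := lt_of_le_of_lt hs10 hρε
  have hτε2 : 2 * Real.sqrt (2 * τ) < ε := by rw [hs2]; linarith
  have hKs : K * Real.sqrt (10 * τ) ≤ 3 * K * ρ := by nlinarith [mul_le_mul_of_nonneg_left hs10 hK]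
  have hτK : K * Real.sqrt (10 * τ) ≤ 1 / 8 := hKs.trans hρK
  set R : ℝ := 2 * Real.sqrt τ + 8 * (K * Real.sqrt (10 * τ)) with hRdef
  have hR0 : 0 ≤ R := by rw [hRdef]; positivity
  have hRle : R ≤ (2 + 24 * K) * ρ := by rw [hRdef]; nlinarith
  have hRsq : R ^ 2 / 4 ≤ ((2 + 24 * K) * ρ) ^ 2 / 4 := by
    have := pow_le_pow_left₀ hR0 hRle 2; linarith
  have hτ' : R ^ 2 / 4 ≤ 1 / 50 := hRsq.trans hR50
  have hU := (latPatternChart_near_data (L := L) hρ0 hw).1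
  obtain ⟨c, ξ', p, hrep, hξ', hslice, hsc, -, hpn⟩ := exists_slice_tubePt_based (L := L) hK hSP hτ0 hτ50 hτε1 hτε2 hτK hτ' hU
  refine ⟨c, ξ', p, hrep, hξ'.trans (by nlinarith), hslice, fun e => le_trans (by linarith) (hsc e), ?_⟩
  calc ‖p‖ ≤ _ := hpn
    _ ≤ 2 * R := norm_bound_of_rep hR0
    _ ≤ (4 + 48 * K) * ρ := by nlinarith

end Summit.QuantumFields.YangMills.Theorems.FemtoTransferGap.TwoLattice.ConstTube

end
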